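import Summits.ResolutionOfSingularities.ResolutionOfSingularities.Theorems.EquisingularLiftEquisingularLiftSectionHorizCentre
import Summits.ResolutionOfSingularities.ResolutionOfSingularities.Theorems.EquisingularLiftEquisingularLiftNatP1VBReductionSections
import Literature.AlgebraicGeometry.Resolution.RegularLocusPerfectFibreScheme
import Literature.AlgebraicGeometry.Resolution.SmoothLocusBaseChange
import Literature.AlgebraicGeometry.Motives.ProjectiveLineUniformisers
import Literature.AlgebraicGeometry.Morphisms.CechH1Projective
import Mathlib.AlgebraicGeometry.Morphisms.Proper
import Mathlib.AlgebraicGeometry.Noetherian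
import Mathlib.FieldTheory.IsAlgClosed.Basic
import HarnessLib

/-!
# [OURS · L1 W4.5(b) · LINE (T-j)-PROOF, BRICK B12] Two disjoint `O`-sections of a proper flat `O`-scheme whose closed fibre is a
# projective line

Cell res-hironaka, LADDER-RESOLUTION rung L, slot W4.5(b), crux chain w45b: EL♮(3) = stmt-ResolutionOfSingularities-20148, residue
(T-j) = F-102 `Literature.AlgebraicGeometry.Resolution.GenusZeroOverCompleteDVR` (LINE (T-j)-PROOF, res-L1-w45b-lead-2 g3; skeleton
`L/res-L1-w45b-lead-2/F102Skeleton.lean`, brick B12 `exists_two_disjoint_sections`, binders verbatim). `--supports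
stmt-ResolutionOfSingularities-20148 --as helper`. NOT a statement of any manuscript; OURS; AI-written, weaker than expert review. No
`sorry`; standard axioms; DEF-FREE.

THEOREM (`exists_two_disjoint_sections`). `O` a complete discrete valuation ring, `θ : O ↠ k` onto an algebraically closed field,
`f : C → Spec O` proper and flat, `(i, t)` a cartesian square over `Spec θ` with `Ck ≅ ℙ¹_{k'}` for some field `k'`. Then `f` has two
sections `s₀, s₁ : Spec O → C` with DISJOINT images.

PROOF. The two rational points `(1:0) ≠ (0:1)` of `ℙ¹_{k'}` (tree `ProjLine.y`, `y_zero_ne_y_one`; closed: `ptHom` is a section of the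
separated `ℙ¹ → Spec k'`) give two distinct closed points `x₀ ≠ x₁` of `C` on the closed fibre (`i` is a closed immersion — base change
of `Spec θ`, tree P1VB part 1). They lie in the smooth locus of `f`: the stalks of `Ck ≅ ℙ¹_{k'}` are regular (smooth over a field,
Stacks 056S, tree `isRegularLocalRing_stalk_of_smooth_of_field`) and a point of the fibre `Ck = C ×_O k` over the perfect `k` with regular
local ring lies over `Sm(C/O)` (tree `isRegularLocalRing_stalk_iff_mem_smoothLocus_of_isPullback`, Stacks 038X/01V8). Hensel's lemma for
smooth morphisms over the complete `O` (tree `StrataSplit.exists_section_horizCentre`, EGA IV₄ 18.5.17; `κ(O) ≅ k` is algebraically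
closed) gives sections `s_j` through `x_j` whose images meet the closed fibre only in `x_j`; a common point `w = s₀(a) = s₁(a)` would
specialise to both `x₀ = s₀(𝔪)` and `x₁ = s₁(𝔪)`, putting `x₀` in the (closed) image of `s₁` — contradiction.
-/

noncomputable section

open CategoryTheory AlgebraicGeometry TopologicalSpace Opposite IsLocalRing
open Literature.AlgebraicGeometry Literature.AlgebraicGeometry.Resolution Literature.AlgebraicGeometry.Motives

set_option linter.dupNamespace false -- mandated namespace `Summit.<Summit>.<Problem>` of this single-conjunct summit

namespace Summit.ResolutionOfSingularities.ResolutionOfSingularities.Cruxes.EquisingularLiftNat.F102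

/-- The rational point `ptᵢ` of `ℙ¹_{k'}` is a closed point (its inclusion `Spec k' → ℙ¹` is a section of the separated structure
morphism, hence a closed immersion, with image `{ptᵢ}`). [folklore] -/
theorem isClosed_singleton_y (k' : Type) [Field k'] (j : Fin 2) : IsClosed ({ProjLine.y k' j} : Set (ProjLine.P k')) := by
  haveI : IsProper (Segre.toSpec (Fin 2) k') := ProjLine.isProper_toSpec k'
  haveI : IsClosedImmersion (ProjLine.ptHom k' j ≫ Segre.toSpec (Fin 2) k') := by
    rw [ProjLine.ptHom_toSpec]
    exact IsClosedImmersion.spec_of_surjective _ (fun a => ⟨a, rfl⟩)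
  haveI : IsClosedImmersion (ProjLine.ptHom k' j) := IsClosedImmersion.of_comp (ProjLine.ptHom k' j) (Segre.toSpec (Fin 2) k')
  have hr : Set.range (ProjLine.ptHom k' j).base = {ProjLine.y k' j} := by
    ext z
    constructor
    · rintro ⟨p, rfl⟩
      rw [Subsingleton.elim p (closedPoint k')]
      rfl
    · rintro rfl
      exact ⟨closedPoint k', rfl⟩
  rw [← hr]
  exact (ProjLine.ptHom k' j).isClosedEmbedding.isClosed_range

/-- Two sections of a morphism to `Spec` of a local ring whose values at the closed point differ, the value of the first lying
outside the (closed) image of the second, have disjoint images: a common point `s₀(a) = s₁(b)` forces `a = b` (apply the structure map)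
and specialises (`a ⤳ 𝔪`) to `s₀(𝔪)` inside the closed image of `s₁`. [folklore] -/
theorem disjoint_range_of_sections {O : Type} [CommRing O] [IsLocalRing O] {C : Scheme.{0}} (f : C ⟶ Spec (.of O))
    (s₀ s₁ : Spec (.of O) ⟶ C) (hs₀ : s₀ ≫ f = 𝟙 _) (hs₁ : s₁ ≫ f = 𝟙 _)
    (hcl : IsClosed (Set.range s₁.base)) (h01 : s₀.base (closedPoint O) ∉ Set.range s₁.base) :
    Disjoint (Set.range s₀.base) (Set.range s₁.base) := by
  rw [Set.disjoint_left]
  rintro w ⟨a, rfl⟩ ⟨b, hb⟩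
  have hab : b = a := by
    have h1 : f.base (s₁.base b) = b := by
      change (s₁ ≫ f).base b = b; rw [hs₁]; rfl
    have h0 : f.base (s₀.base a) = a := by
      change (s₀ ≫ f).base a = a; rw [hs₀]; rfl
    rw [← h1, hb, h0]
  subst hab
  -- `s₀ b ⤳ s₀ 𝔪`, and the image of `s₁` is closed and contains `s₀ b = s₁ b`
  have hspec : s₀.base b ⤳ s₀.base (closedPoint O) := (IsLocalRing.specializes_closedPoint b).map s₀.base.hom.continuous
  exact h01 (hcl.closure_subset_iff.mpr (Set.singleton_subset_iff.mpr ⟨b, hb⟩) (hspec.mem_closure))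

/-- **BRICK B12 — two disjoint `O`-sections.** `O` a complete discrete valuation ring, `θ : O ↠ k` onto an algebraically closed
field, `f : C → Spec O` proper and flat, `IsPullback i t f (Spec θ)` with `Ck ≅ ℙ¹_{k'}`: there are sections `s₀, s₁` of `f`
with disjoint images (Hensel through the two rational points `(1:0)`, `(0:1)` of the smooth closed fibre). [OURS] -/
theorem exists_two_disjoint_sections (O : Type) [CommRing O] [IsDomain O] [IsDiscreteValuationRing O]
    [IsAdicComplete (maximalIdeal O) O] (k : Type) [Field k] [IsAlgClosed k] (θ : O →+* k)
    (C : Scheme.{0}) (f : C ⟶ Spec (.of O)) [IsProper f] [Flat f]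
    (Ck : Scheme.{0}) (i : Ck ⟶ C) (t : Ck ⟶ Spec (.of k))
    (hθ : Function.Surjective θ) (_hreg : Resolution.Scheme.IsRegular C)
    (hsq : IsPullback i t f (Spec.map (CommRingCat.ofHom θ)))
    (hP1 : ∃ (k' : Type) (_ : Field k'), Nonempty (Ck ≅ Morphisms.ProjCech.PP k' 1)) :
    ∃ s₀ s₁ : Spec (.of O) ⟶ C, s₀ ≫ f = 𝟙 _ ∧ s₁ ≫ f = 𝟙 _ ∧
      Disjoint (Set.range s₀.base) (Set.range s₁.base) := by
  obtain ⟨k', _, ⟨e⟩⟩ := hP1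
  -- `κ(O) ≅ k` is algebraically closed; `ker θ = 𝔪`
  have hker : RingHom.ker θ = maximalIdeal O :=
    IsLocalRing.eq_maximalIdeal (RingHom.ker_isMaximal_of_surjective θ hθ)
  haveI : IsAlgClosed (ResidueField O) := by
    have e₁ : ResidueField O ≃+* k :=
      (Ideal.quotEquivOfEq hker.symm).trans (RingHom.quotientKerEquivOfSurjective hθ)
    exact IsAlgClosed.of_ringEquiv k (ResidueField O) e₁.symm
  letI : Algebra O k := θ.toAlgebra
  haveI : IsClosedImmersion i := P1VB.isClosedImmersion_of_isPullback θ f hθ hsq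
  haveI : IsLocalHom θ := by
    refine ⟨fun a ha => ?_⟩
    by_contra h
    have hmem : a ∈ RingHom.ker θ := by rw [hker]; exact (IsLocalRing.mem_maximalIdeal a).mpr h
    exact ha.ne_zero ((RingHom.mem_ker).mp hmem)
  -- the two rational points of the closed fibre, as closed points of `C` over `𝔪`
  let y : Fin 2 → Ck := fun j => e.inv.base (ProjLine.y k' j)
  let x : Fin 2 → C := fun j => i.base (y j)
  have hey : ∀ j, e.hom.base (y j) = ProjLine.y k' j := fun j => by
    change (e.inv ≫ e.hom).base (ProjLine.y k' j) = _
    rw [e.inv_hom_id]; rfl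
  have hx01 : x 0 ≠ x 1 := by
    intro h
    have h' : y 0 = y 1 := i.isClosedEmbedding.injective h
    have h'' := congrArg e.hom.base h'
    rw [hey, hey] at h''
    exact ProjLine.y_zero_ne_y_one k' h''
  have hxcl : ∀ j, IsClosed ({x j} : Set C) := fun j => by
    have h1 : IsClosed ({y j} : Set Ck) := by
      have h2 : ({y j} : Set Ck) = e.inv.base '' {ProjLine.y k' j} := by rw [Set.image_singleton]
      rw [h2]
      exact e.inv.isClosedEmbedding.isClosedMap _ (isClosed_singleton_y k' j)
    have h3 : ({x j} : Set C) = i.base '' {y j} := by rw [Set.image_singleton]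
    rw [h3]
    exact i.isClosedEmbedding.isClosedMap _ h1
  have hfx : ∀ j, f.base (x j) = closedPoint O := fun j => by
    change (i ≫ f).base (y j) = _
    rw [hsq.w]
    change (Spec.map (CommRingCat.ofHom θ)).base (t.base (y j)) = _
    rw [Subsingleton.elim (t.base (y j)) (closedPoint k)]
    exact Spec_closedPoint (f := CommRingCat.ofHom θ)
  -- the closed fibre is smooth: its points lie in the smooth locus of `f`
  haveI : Smooth (Segre.toSpec (Fin 2) k') := (ProjLine.smoothOfRelativeDimension_one_toSpec k').smooth
  have hsm : ∀ j, x j ∈ f.smoothLocus := fun j => by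
    have hregP : IsRegularLocalRing ((ProjLine.P k').presheaf.stalk (e.hom.base (y j))) :=
      isRegularLocalRing_stalk_of_smooth_of_field (Segre.toSpec (Fin 2) k') _
    have hregCk : IsRegularLocalRing (Ck.presheaf.stalk (y j)) :=
      (isRegularLocalRing_stalk_iff_of_isOpenImmersion e.hom (y j)).mp hregP
    exact (isRegularLocalRing_stalk_iff_mem_smoothLocus_of_isPullback k (q := f) hsq (y j)).mp hregCk
  -- Hensel: sections through `x₀`, `x₁`
  have hsec : ∀ j, ∃ s : Spec (.of O) ⟶ C, s ≫ f = 𝟙 _ ∧ s.base (closedPoint O) = x j ∧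
      ∀ z : C, f.base z = closedPoint O → z ≠ x j → z ∉ (s.ker.support : Set C) := fun j => by
    obtain ⟨V, hxV, hV⟩ := exists_smooth_ι_comp_of_mem_smoothLocus f (hsm j)
    obtain ⟨s, hs, hsx, -, -, hsupp⟩ :=
      EquisingularLift.StrataSplit.exists_section_horizCentre O C f V hV (x j) (hxcl j) hxV (hfx j)
    exact ⟨s, hs, hsx, hsupp⟩
  obtain ⟨s₀, hs₀, hs₀x, -⟩ := hsec 0
  obtain ⟨s₁, hs₁, hs₁x, hsupp₁⟩ := hsec 1
  haveI : IsClosedImmersion (s₁ ≫ f) := by rw [hs₁]; infer_instance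
  haveI : IsClosedImmersion s₁ := IsClosedImmersion.of_comp s₁ f
  refine ⟨s₀, s₁, hs₀, hs₁, disjoint_range_of_sections f s₀ s₁ hs₀ hs₁ s₁.isClosedEmbedding.isClosed_range ?_⟩
  rw [hs₀x]
  exact fun hmem => hsupp₁ (x 0) (hfx 0) hx01 (s₁.range_subset_ker_support hmem)

/-- **BRICK B12, v2 (appended 2026-08-27T22:00Z) — two disjoint `O`-sections THROUGH the two rational points of a CHOSEN
fibre iso.** Same as `exists_two_disjoint_sections`, exporting the iso `e : Ck ≅ ℙ¹_{k'}` used and the facts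
`s_j(𝔪) = i(e⁻¹ ptⱼ)` (`pt₀ = (1:0)`, `pt₁ = (0:1)`, tree `ProjLine.y`) — the binder form B4/S5 of LINE (T-j)-PROOF consume (text-owner
word 22:00Z on the desk's BINDER QUESTION 21:42:37Z: no automorphism of `ℙ¹` is needed, the sections are BUILT through these points).
**BRICK B12 — two disjoint `O`-sections.** `O` a complete discrete valuation ring, `θ : O ↠ k` onto an algebraically closed
field, `f : C → Spec O` proper and flat, `IsPullback i t f (Spec θ)` with `Ck ≅ ℙ¹_{k'}`: there are sections `s₀, s₁` of `f`
with disjoint images (Hensel through the two rational points `(1:0)`, `(0:1)` of the smooth closed fibre). [OURS] -/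
theorem exists_two_disjoint_sections_through (O : Type) [CommRing O] [IsDomain O] [IsDiscreteValuationRing O]
    [IsAdicComplete (maximalIdeal O) O] (k : Type) [Field k] [IsAlgClosed k] (θ : O →+* k)
    (C : Scheme.{0}) (f : C ⟶ Spec (.of O)) [IsProper f] [Flat f]
    (Ck : Scheme.{0}) (i : Ck ⟶ C) (t : Ck ⟶ Spec (.of k))
    (hθ : Function.Surjective θ) (_hreg : Resolution.Scheme.IsRegular C)
    (hsq : IsPullback i t f (Spec.map (CommRingCat.ofHom θ)))
    (hP1 : ∃ (k' : Type) (_ : Field k'), Nonempty (Ck ≅ Morphisms.ProjCech.PP k' 1)) :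
    ∃ (k' : Type) (_ : Field k') (e : Ck ≅ Morphisms.ProjCech.PP k' 1) (s₀ s₁ : Spec (.of O) ⟶ C),
      s₀ ≫ f = 𝟙 _ ∧ s₁ ≫ f = 𝟙 _ ∧
      s₀.base (closedPoint O) = i.base (e.inv.base (ProjLine.y k' 0)) ∧
      s₁.base (closedPoint O) = i.base (e.inv.base (ProjLine.y k' 1)) ∧
      Disjoint (Set.range s₀.base) (Set.range s₁.base) := by
  obtain ⟨k', hk', ⟨e⟩⟩ := hP1
  -- `κ(O) ≅ k` is algebraically closed; `ker θ = 𝔪`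
  have hker : RingHom.ker θ = maximalIdeal O :=
    IsLocalRing.eq_maximalIdeal (RingHom.ker_isMaximal_of_surjective θ hθ)
  haveI : IsAlgClosed (ResidueField O) := by
    have e₁ : ResidueField O ≃+* k :=
      (Ideal.quotEquivOfEq hker.symm).trans (RingHom.quotientKerEquivOfSurjective hθ)
    exact IsAlgClosed.of_ringEquiv k (ResidueField O) e₁.symm
  letI : Algebra O k := θ.toAlgebra
  haveI : IsClosedImmersion i := P1VB.isClosedImmersion_of_isPullback θ f hθ hsq
  haveI : IsLocalHom θ := by
    refine ⟨fun a ha => ?_⟩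
    by_contra h
    have hmem : a ∈ RingHom.ker θ := by rw [hker]; exact (IsLocalRing.mem_maximalIdeal a).mpr h
    exact ha.ne_zero ((RingHom.mem_ker).mp hmem)
  -- the two rational points of the closed fibre, as closed points of `C` over `𝔪`
  let y : Fin 2 → Ck := fun j => e.inv.base (ProjLine.y k' j)
  let x : Fin 2 → C := fun j => i.base (y j)
  have hey : ∀ j, e.hom.base (y j) = ProjLine.y k' j := fun j => by
    change (e.inv ≫ e.hom).base (ProjLine.y k' j) = _
    rw [e.inv_hom_id]; rfl
  have hx01 : x 0 ≠ x 1 := by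
    intro h
    have h' : y 0 = y 1 := i.isClosedEmbedding.injective h
    have h'' := congrArg e.hom.base h'
    rw [hey, hey] at h''
    exact ProjLine.y_zero_ne_y_one k' h''
  have hxcl : ∀ j, IsClosed ({x j} : Set C) := fun j => by
    have h1 : IsClosed ({y j} : Set Ck) := by
      have h2 : ({y j} : Set Ck) = e.inv.base '' {ProjLine.y k' j} := by rw [Set.image_singleton]
      rw [h2]
      exact e.inv.isClosedEmbedding.isClosedMap _ (isClosed_singleton_y k' j)
    have h3 : ({x j} : Set C) = i.base '' {y j} := by rw [Set.image_singleton]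
    rw [h3]
    exact i.isClosedEmbedding.isClosedMap _ h1
  have hfx : ∀ j, f.base (x j) = closedPoint O := fun j => by
    change (i ≫ f).base (y j) = _
    rw [hsq.w]
    change (Spec.map (CommRingCat.ofHom θ)).base (t.base (y j)) = _
    rw [Subsingleton.elim (t.base (y j)) (closedPoint k)]
    exact Spec_closedPoint (f := CommRingCat.ofHom θ)
  -- the closed fibre is smooth: its points lie in the smooth locus of `f`
  haveI : Smooth (Segre.toSpec (Fin 2) k') := (ProjLine.smoothOfRelativeDimension_one_toSpec k').smooth
  have hsm : ∀ j, x j ∈ f.smoothLocus := fun j => by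
    have hregP : IsRegularLocalRing ((ProjLine.P k').presheaf.stalk (e.hom.base (y j))) :=
      isRegularLocalRing_stalk_of_smooth_of_field (Segre.toSpec (Fin 2) k') _
    have hregCk : IsRegularLocalRing (Ck.presheaf.stalk (y j)) :=
      (isRegularLocalRing_stalk_iff_of_isOpenImmersion e.hom (y j)).mp hregP
    exact (isRegularLocalRing_stalk_iff_mem_smoothLocus_of_isPullback k (q := f) hsq (y j)).mp hregCk
  -- Hensel: sections through `x₀`, `x₁`
  have hsec : ∀ j, ∃ s : Spec (.of O) ⟶ C, s ≫ f = 𝟙 _ ∧ s.base (closedPoint O) = x j ∧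
      ∀ z : C, f.base z = closedPoint O → z ≠ x j → z ∉ (s.ker.support : Set C) := fun j => by
    obtain ⟨V, hxV, hV⟩ := exists_smooth_ι_comp_of_mem_smoothLocus f (hsm j)
    obtain ⟨s, hs, hsx, -, -, hsupp⟩ :=
      EquisingularLift.StrataSplit.exists_section_horizCentre O C f V hV (x j) (hxcl j) hxV (hfx j)
    exact ⟨s, hs, hsx, hsupp⟩
  obtain ⟨s₀, hs₀, hs₀x, -⟩ := hsec 0
  obtain ⟨s₁, hs₁, hs₁x, hsupp₁⟩ := hsec 1
  haveI : IsClosedImmersion (s₁ ≫ f) := by rw [hs₁]; infer_instance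
  haveI : IsClosedImmersion s₁ := IsClosedImmersion.of_comp s₁ f
  refine ⟨k', hk', e, s₀, s₁, hs₀, hs₁, hs₀x, hs₁x,
    disjoint_range_of_sections f s₀ s₁ hs₀ hs₁ s₁.isClosedEmbedding.isClosed_range ?_⟩
  rw [hs₀x]
  exact fun hmem => hsupp₁ (x 0) (hfx 0) hx01 (s₁.range_subset_ker_support hmem)

end Summit.ResolutionOfSingularities.ResolutionOfSingularities.Cruxes.EquisingularLiftNat.F102

end
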